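import Literature.MathematicalPhysics.QuantumFieldTheory.Balaban1983to89.Node00.Record12BgRowTopDomain
import Literature.MathematicalPhysics.QuantumFieldTheory.Balaban1983to89.Node00.Record12BgRowCoClassC

/-!
# NODE 00 — ROW P11 UNDER F7: [15] THEOREM 1 OVER PRINT'S CLASS (6) ON A TOP DOMAIN `Ω₀` (the support), C′ comparability — `VariationalThm1RegSepTop7 F N Sup B₃ a₀ a₁`,
# GENERIC in a support selector `Sup`, and the row's suppliers for an arbitrary minimiser over that class (node00-def-R's FILE 22′ instantiates `Sup := suppDomOfRecord`)

Cell `pub-ymgap`, seat `pub-ymgap-node00-def-P11` g3 (R218).  director-ym №160∕№162 (FINDING №7, fix F7 adopted, (y) FINAL: RECORD 13 v1.5 `CoP` re-seeds the background on def-R's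
collar-ranged class `regMSCoPOfRecord`; EDITION FREEZE); def-T (S) SCOPE INPUT (INBOX l.18319); def-R SCOPE WORD D1–D9 (l.18343); this seat's LEVEL0-RANGES ∕ WORD = TWIN ∕ DECL-DELTA-12a
(l.18283 ∕ l.18347 ∕ l.18397).  [15] = [Balaban1985Variational]; [6] = [Balaban1985RegularSpaces]; [III] = [Balaban1988Convergent]; [I] = [Balaban1987RG1].

WHAT CHANGES RELATIVE TO FILE 11's `VariationalThm1RegSepCo7` (print [15] p.278: the space `U_k({Ω_j}, ε₀)` is «of gauge field configurations ON Ω₀», (2) «p ∈ Ω_j, b ∈ Ω_j, j = 0, …, k»,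
the data (3) on `Λ_j ⊂ Ω₀`, the action (5) «Σ_{p ⊂ Ω₀}»; [III] p.255: `Ω₀` = the SUPPORT, «Ω₁, or rather a small neighborhood of Ω₁ including a layer of M₁-cubes»): the THREE scale-0
ranges that FILE 11 reads on the whole torus (`omegaPlaqs s.Ω 0 = univ`, `Sect2.omegaBonds s.Ω 0 = univ`, `Sect2.printedPlaqs s.Ω k 0` ⊇ everything outside `Ω₁`) are read on a top domain
`Ω₀ = Sup ν K s.Ω` (FILE 12a's `Sect2.omegaPlaqsTop ∕ omegaBondsTop ∕ printedPlaqsTop`): class (1.7)₀∕(1.9)₀, data (7)₀ and conclusion (8)₀ together (my LEVEL0-RANGES (B1)–(B3): moved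
one at a time they re-create FINDING №7 one row down).  Everything at the scales `1 ≤ n ≤ k`, the separation, the thresholds `0 < δ_n ≤ a₁`, `B₃δ_n ≤ ε₀ ≤ a₀`, the TWO-SIDED comparability
(C′, LOCATED-M4) and the (R)-reading are FILE 11's, byte for byte.  The support is a PARAMETER `Sup` (a selector `(ν, K, Ω) ↦ Ω₀`, def-R's `suppDomOfRecord` has exactly this shape), NOT a
`∀ Ω₀` inside the sentence: a universally quantified top domain would be refutable through thin protrusions of a free `Ω₀` (conclusion (8)₀ on `plaqsOf Ω₀` vs. no (7)₀ datum there), the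
way a free `δ 0` refuted `…Co6`; print's `Ω₀` is ONE admissible domain ([15] p.277 (1)).  The constraint region `Γ₀ = Ω₁ᶜ` (`genSet`, [III] (2.2), (1.12) «U = V₀ on Ω₁ᶜ») is unchanged:
pinning `U` beyond `Ω₀`, where it is no variable of (5), changes no argmin (def-T (S), def-R (B)).

CONTENTS.  §1 ★★ `VariationalThm1RegSepTop7 F N Sup B₃ a₀ a₁` (def, NEVER asserted; class literal = def-R's D3 `regMSCoPOfRecordAt … Ω₀ Ω` with `εreg ↦ ε₀`, up to `rfl` — FILE 12a's
`Sect2.omegaPlaqsTop ∕ CoDivClassOnTop` put the `if` inside `plaqsOf ∕ bondsOf` as `seqTop` does), `.of_le`; the `Ω₀ = T_η` bridges `VariationalThm1RegSepTop7.toCo7_univ` ∕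
`VariationalThm1RegSepCo7.toTop7_univ` (FILE 11's fact IS the top-domain fact at the constant selector `univ`).  §2 suppliers GENERIC in the minimiser and in `Sup`:
`plaqSmallOn_of_thm1RegSepTop7`, `coDivSmallOn_of_thm1RegSepTop7`, ★★★ `bgRowAtDatumU_of_thm1RegSepTop7C1` (FILE 12a §4's scale-0-free analysis fed by the conclusion at `1 ≤ n`).
The instantiation at def-R's `UbgMSCoPOfRecord` (`Sup := suppDomOfRecord`, token `VariationalThm1RegSepCoP7`) is `Node00/Record12BgRowCoClassCP.lean` on FILE 22′ (INTENT-12c).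

HONEST FRAMING.  Statement architecture + bookkeeping around ONE NAMED FACT (a `Prop` with print's constants AND the support selector as parameters, NEVER asserted); nothing of Bałaban
asserted or discharged; K0⁗ NOT closed; counts unmoved (typed 28∕28 · discharged 5∕28); one finite `𝕋⁴` torus family at fixed `ε = L^{−K}`; not continuum ∕ OS ∕ mass gap ∕ Clay.
`SU(N)` model of record.  One `def` (the fact), no `instance`, no `sorry`.

DEPENDENCES (by name): FILE 12a `Node00.Record12BgRowTopDomain` (`Sect2.omegaPlaqsTop(_of_ne_zero ∕ _univ)`, `Sect2.omegaBondsTop(_univ)`, `Sect2.CoDivClassOnTop`,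
`Sect2.coDivClassOnTop_univ_iff`, `Sect2.DataSmall7PTop`, `Sect2.dataSmall7PTop_univ_iff`, `bgRowAtDatumU_of_classBoundsC1Pos`), FILE 11 `Node00.Record12BgRowCoClassC`
(`VariationalThm1RegSepCo7`), FILE 7c (`hletterI∕MS_of_numerics`), FILE 16 `omegaPlaqs` (def-R), r11 `IsMinimizer`, `avOfRecord`, `genSet`, `epsOfRecord`, FILE 2 `Sect2.SeqSeparated`.
-/

noncomputable section

open MeasureTheory
open scoped Matrix.Norms.L2Operator

namespace Literature.MathematicalPhysics.QuantumFieldTheory.Balaban1983to89.Node00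

open T4Continuum B14.Eq218Concrete B15DeterminingSets B12RegularSpaces111 B14RegularSpaces234 B14Radii T4AxialGaugeSmallField

/-! ## §1  [15] THEOREM 1 OVER PRINT'S CLASS (6) OF CONFIGURATIONS ON A TOP DOMAIN, TWO-SIDED COMPARABILITY — the named fact, generic in the support selector -/

section NamedFactTop

variable (F : T4Family) (N : ℕ) [NeZero N]

/-- **★★ NAMED FACT, TOP-DOMAIN EDITION — [15] THEOREM 1, (R)-READING, THE MINIMISER RANGING OVER PRINT'S CLASS (6) = [6] (1.7) ∧ (1.9) AT `ε₀` OF CONFIGURATIONS ON THE SUPPORT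
`Ω₀ = Sup ν K s.Ω`, THRESHOLDS COMPARABLE BOTH WAYS** (director-ym №160 F7 ∕ №149 (3) class edition ∕ dag-n07-e LOCATED-M4 repair C′; a `Prop` with parameters, NEVER asserted): for a
separated `s`, thresholds `0 < δ_n ≤ a₁`, `B₃δ_n ≤ ε₀ ≤ a₀`, `δ_n ≤ 2δ_{n+1}` AND `δ_{n+1} ≤ 2δ_n`, a datum `𝐖` with print's (7) — level 0 on the printed plaquettes MEETING `Ω₀`
(`Sect2.DataSmall7PTop`), levels `≥ 1` on the CONCORD range — EVERY minimiser `U₀` of (2.12) on `𝔅({Ω_j}) = genSet s.Ω k` over the class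
`U_k({Ω_j}_{j=0}^{k}, ε₀) = {U | (∀ n ≤ k, |U(∂p) − 1| < ε₀η_n² for p meeting Ω_n) ∧ (∀ n ≤ k, ‖η·D^{η*}_U ∂U(b)‖ < ε₀η_n³ for b meeting Ω_n)}`, `Ω₀ := Sup ν K s.Ω` (def-R's FILE 22′
`regMSCoPOfRecordAt … Ω₀ s.Ω` at `εreg ↦ ε₀`, `rfl`), lies in (8): plaquettes `< B₃δ_n·η_n²` on the plaquettes meeting `Ω_n` AND co-divergence `< B₃δ_n·η_n³` on the bonds meeting `Ω_n`,
every `n ≤ k`, scale `0` read on `Ω₀`.  Print p.279: «there exists a minimal orbit in the space (8) U_k({Ω_j}, B₃ε₁) … This orbit is a unique critical orbit in the space (6) if B₃ε₁ ≤ ε₀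
and ε₀ ≤ a₀».  At the constant selector `Sup = univ` this IS FILE 11's `VariationalThm1RegSepCo7` (`toCo7_univ` ∕ `toTop7_univ`).  The support is a PARAMETER: print's `Ω₀` is ONE
admissible domain ([15] p.277 (1): `Ω₀ ⊇ Ω₁ ⊇ …`, `dist(Ω₀ᶜ, Ω₁) > RM₁`; [III] p.255: `Ω₁` + a layer of `M₁`-cubes = def-R's `suppDomOfRecord`); at a selector violating (1) the
sentence is not print's and may fail (no (7)₀ datum where (8)₀ is demanded) — consumers instantiate `Sup := suppDomOfRecord` only.  Inhabitation floor displayed by consumers: `2L² ≤ B₃`.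
-- TODO(general form): ONE threshold ε₁ in print; general admissible `{Ω_j}`∕`𝔅_k` ([6] Sect. A) and print's separation letter `R ≥ R₁`; orbit uniqueness and (9)–(10) are not part of this sentence.
[cite: Balaban1985Variational, (1) p.277, Thm 1 (2),(3),(5),(6),(7)–(8) pp.278–279; Balaban1985RegularSpaces, (1.1)–(1.2) p.76, (1.7)–(1.9) p.77; Balaban1988Convergent, p.255, (2.6)–(2.8) pp.255–256, (2.12) p.256] -/
def VariationalThm1RegSepTop7 (Sup : (ν : Stage7Numerics) → (K : ℕ) → (ℕ → Set (Site (F.P K) 0)) → Set (Site (F.P K) 0)) (B₃ a₀ a₁ : ℝ) : Prop :=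
  ∀ (ν : Stage7Numerics) (M : ℕ) (g : ℕ → ℝ) (K k : ℕ) (s : SeqOfRecord F ν M g K k), Sect2.SeqSeparated ν.M₁ s → ∀ (ε₀ : ℝ) (δ : ℕ → ℝ),
    (∀ n, n ≤ k → 0 < δ n ∧ δ n ≤ a₁ ∧ B₃ * δ n ≤ ε₀) → (∀ n, n < k → δ n ≤ 2 * δ (n + 1)) → (∀ n, n < k → δ (n + 1) ≤ 2 * δ n) → ε₀ ≤ a₀ →
    ∀ W : MSField (F.P K) (SU N), Sect2.DataSmall7PTop (avOfRecord F N K) s.Ω (Sup ν K s.Ω) k δ W →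
      ∀ U₀, IsMinimizer (avOfRecord F N K)
          {U | (∀ n, n ≤ k → PlaqSmallOn (Sect2.omegaPlaqsTop s.Ω (Sup ν K s.Ω) n) (ε₀ * (F.P K).eta n ^ 2) U) ∧
            Sect2.CoDivClassOnTop s.Ω (Sup ν K s.Ω) k ε₀ U} (genSet s.Ω k) W U₀ →
        (∀ n, n ≤ k → PlaqSmallOn (Sect2.omegaPlaqsTop s.Ω (Sup ν K s.Ω) n) (B₃ * δ n * (F.P K).eta n ^ 2) U₀) ∧
          ∀ n, n ≤ k → Sect2.CoDivSmallOn (Sect2.omegaBondsTop s.Ω (Sup ν K s.Ω) n) (B₃ * δ n * (F.P K).eta n ^ 3) U₀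

variable {F N}

/-- The top-domain fact is ANTITONE in `a₀`, `a₁` (the letters enter only as ceilings; cf. FILE 11 `VariationalThm1RegSepCo7.of_le`). [cite: Balaban1985Variational, Thm 1 p.279 (the range «ε₀ ≤ a₀», «ε₁ ≤ a₁»)] -/
theorem VariationalThm1RegSepTop7.of_le {Sup : (ν : Stage7Numerics) → (K : ℕ) → (ℕ → Set (Site (F.P K) 0)) → Set (Site (F.P K) 0)} {B₃ a₀ a₀' a₁ a₁' : ℝ}
    (h : VariationalThm1RegSepTop7 F N Sup B₃ a₀ a₁) (ha₀ : a₀' ≤ a₀) (ha₁ : a₁' ≤ a₁) : VariationalThm1RegSepTop7 F N Sup B₃ a₀' a₁' :=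
  fun ν M g K k s hsep ε₀ δ hnum hcomp hcomp' hε W h7 U₀ hmin =>
    h ν M g K k s hsep ε₀ δ (fun n hn => ⟨(hnum n hn).1, (hnum n hn).2.1.trans ha₁, (hnum n hn).2.2⟩) hcomp hcomp' (hε.trans ha₀) W h7 U₀ hmin

/-- The class literal of the top-domain fact at the constant selector `univ` IS FILE 11's class literal (FILE 12a's `omegaPlaqsTop_univ`, `coDivClassOnTop_univ_iff`).
[cite: Balaban1985RegularSpaces, (1.3),(1.7),(1.9) p.77 (bookkeeping)] -/
theorem setOf_top_univ_eq (ν : Stage7Numerics) (M : ℕ) (g : ℕ → ℝ) (K k : ℕ) (s : SeqOfRecord F ν M g K k) (ε₀ : ℝ) :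
    {U : GaugeField (F.P K) 0 (SU N) | (∀ n, n ≤ k → PlaqSmallOn (Sect2.omegaPlaqsTop s.Ω (Set.univ : Set (Site (F.P K) 0)) n) (ε₀ * (F.P K).eta n ^ 2) U) ∧
        Sect2.CoDivClassOnTop s.Ω Set.univ k ε₀ U} =
      {U | (∀ n, n ≤ k → PlaqSmallOn (omegaPlaqs s.Ω n) (ε₀ * (F.P K).eta n ^ 2) U) ∧ Sect2.CoDivClassOn s.Ω k ε₀ U} := by
  ext U
  simp only [Set.mem_setOf_eq, Sect2.omegaPlaqsTop_univ, Sect2.coDivClassOnTop_univ_iff]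

/-- **AT THE CONSTANT SELECTOR `Ω₀ = T_η` THE TOP-DOMAIN FACT GIVES FILE 11's `VariationalThm1RegSepCo7`.** [cite: Balaban1985Variational, Thm 1 (8) p.279 (bookkeeping); Balaban1985RegularSpaces, (1.3) p.77] -/
theorem VariationalThm1RegSepTop7.toCo7_univ {B₃ a₀ a₁ : ℝ} (h : VariationalThm1RegSepTop7 F N (fun _ K _ => (Set.univ : Set (Site (F.P K) 0))) B₃ a₀ a₁) :
    VariationalThm1RegSepCo7 F N B₃ a₀ a₁ := by
  intro ν M g K k s hsep ε₀ δ hnum hcomp hcomp' hε W h7 U₀ hmin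
  have h7' : Sect2.DataSmall7PTop (avOfRecord F N K) s.Ω (Set.univ : Set (Site (F.P K) 0)) k δ W :=
    (Sect2.dataSmall7PTop_univ_iff _ _ _ _ _).mpr h7
  have hmin' : IsMinimizer (avOfRecord F N K)
      {U : GaugeField (F.P K) 0 (SU N) | (∀ n, n ≤ k → PlaqSmallOn (Sect2.omegaPlaqsTop s.Ω (Set.univ : Set (Site (F.P K) 0)) n) (ε₀ * (F.P K).eta n ^ 2) U) ∧
        Sect2.CoDivClassOnTop s.Ω Set.univ k ε₀ U} (genSet s.Ω k) W U₀ := by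
    rw [setOf_top_univ_eq]; exact hmin
  obtain ⟨h1, h2⟩ := h ν M g K k s hsep ε₀ δ hnum hcomp hcomp' hε W h7' U₀ hmin'
  refine ⟨fun n hn => ?_, fun n hn => ?_⟩
  · have := h1 n hn
    rwa [Sect2.omegaPlaqsTop_univ] at this
  · have := h2 n hn
    rwa [Sect2.omegaBondsTop_univ] at this

/-- **CONVERSELY, FILE 11's `VariationalThm1RegSepCo7` IS THE TOP-DOMAIN FACT AT `Ω₀ = T_η`.** [cite: Balaban1985Variational, Thm 1 (8) p.279 (bookkeeping); Balaban1985RegularSpaces, (1.3) p.77] -/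
theorem VariationalThm1RegSepCo7.toTop7_univ {B₃ a₀ a₁ : ℝ} (h : VariationalThm1RegSepCo7 F N B₃ a₀ a₁) :
    VariationalThm1RegSepTop7 F N (fun _ K _ => (Set.univ : Set (Site (F.P K) 0))) B₃ a₀ a₁ := by
  intro ν M g K k s hsep ε₀ δ hnum hcomp hcomp' hε W h7 U₀ hmin
  have h7' : Sect2.DataSmall7P (avOfRecord F N K) s.Ω k δ W := (Sect2.dataSmall7PTop_univ_iff _ _ _ _ _).mp h7
  have hmin' : IsMinimizer (avOfRecord F N K)
      {U | (∀ n, n ≤ k → PlaqSmallOn (omegaPlaqs s.Ω n) (ε₀ * (F.P K).eta n ^ 2) U) ∧ Sect2.CoDivClassOn s.Ω k ε₀ U} (genSet s.Ω k) W U₀ := by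
    rw [← setOf_top_univ_eq]; exact hmin
  obtain ⟨h1, h2⟩ := h ν M g K k s hsep ε₀ δ hnum hcomp hcomp' hε W h7' U₀ hmin'
  refine ⟨fun n hn => ?_, fun n hn => ?_⟩
  · rw [Sect2.omegaPlaqsTop_univ]; exact h1 n hn
  · rw [Sect2.omegaBondsTop_univ]; exact h2 n hn

end NamedFactTop

/-! ## §2  Suppliers GENERIC IN THE MINIMISER over the top-domain class (6) and in the support selector -/

section SuppliersTop

variable {F : T4Family} {N : ℕ} [NeZero N]

/-- **★ EVERY MINIMISER OVER THE TOP-DOMAIN CLASS (6) AT THE RECORD'S LETTERS IS `B₃·cR·ε_n`-REGULAR (plaquettes meeting `Ω_n`, scale 0 on the support)** for a separated sequence,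
thresholds comparable both ways and a datum with print's (7) on the support, from the top-domain fact; `εreg` generic. [cite: Balaban1985Variational, Thm 1 (2),(6)–(8) pp.278–279; Balaban1988Convergent, (2.6)–(2.8) pp.255–256, (2.12) p.256] -/
theorem plaqSmallOn_of_thm1RegSepTop7 {Sup : (ν : Stage7Numerics) → (K : ℕ) → (ℕ → Set (Site (F.P K) 0)) → Set (Site (F.P K) 0)} {B₃ a₀ a₁ : ℝ}
    (h15 : VariationalThm1RegSepTop7 F N Sup B₃ a₀ a₁) (ν : Stage7Numerics) (M : ℕ)
    (g : ℕ → ℝ) (K k : ℕ) (cR : ℝ) (s : SeqOfRecord F ν M g K k) (hsep : Sect2.SeqSeparated ν.M₁ s)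
    (hnum : ∀ n, n ≤ k → 0 < cR * epsOfRecord ν g n ∧ cR * epsOfRecord ν g n ≤ a₁ ∧ B₃ * (cR * epsOfRecord ν g n) ≤ ν.εreg) (ha₀ : ν.εreg ≤ a₀)
    (hcomp : ∀ n, n < k → cR * epsOfRecord ν g n ≤ 2 * (cR * epsOfRecord ν g (n + 1)))
    (hcomp' : ∀ n, n < k → cR * epsOfRecord ν g (n + 1) ≤ 2 * (cR * epsOfRecord ν g n))
    {W : MSField (F.P K) (SU N)} (h7 : Sect2.DataSmall7PTop (avOfRecord F N K) s.Ω (Sup ν K s.Ω) k (fun n => cR * epsOfRecord ν g n) W)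
    {U₀ : GaugeField (F.P K) 0 (SU N)} (hmin : IsMinimizer (avOfRecord F N K)
      {U | (∀ n, n ≤ k → PlaqSmallOn (Sect2.omegaPlaqsTop s.Ω (Sup ν K s.Ω) n) (ν.εreg * (F.P K).eta n ^ 2) U) ∧
        Sect2.CoDivClassOnTop s.Ω (Sup ν K s.Ω) k ν.εreg U} (genSet s.Ω k) W U₀) :
    ∀ n, n ≤ k → PlaqSmallOn (Sect2.omegaPlaqsTop s.Ω (Sup ν K s.Ω) n) (B₃ * (cR * epsOfRecord ν g n) * (F.P K).eta n ^ 2) U₀ :=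
  (h15 ν M g K k s hsep ν.εreg (fun n => cR * epsOfRecord ν g n) hnum hcomp hcomp' ha₀ W h7 U₀ hmin).1

/-- The co-divergence half ((8)'s second member, scale 0 on the support) for every minimiser over the top-domain class. [cite: Balaban1985Variational, Thm 1 (8) p.279; Balaban1985RegularSpaces, (1.9) p.77] -/
theorem coDivSmallOn_of_thm1RegSepTop7 {Sup : (ν : Stage7Numerics) → (K : ℕ) → (ℕ → Set (Site (F.P K) 0)) → Set (Site (F.P K) 0)} {B₃ a₀ a₁ : ℝ}
    (h15 : VariationalThm1RegSepTop7 F N Sup B₃ a₀ a₁) (ν : Stage7Numerics) (M : ℕ)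
    (g : ℕ → ℝ) (K k : ℕ) (cR : ℝ) (s : SeqOfRecord F ν M g K k) (hsep : Sect2.SeqSeparated ν.M₁ s)
    (hnum : ∀ n, n ≤ k → 0 < cR * epsOfRecord ν g n ∧ cR * epsOfRecord ν g n ≤ a₁ ∧ B₃ * (cR * epsOfRecord ν g n) ≤ ν.εreg) (ha₀ : ν.εreg ≤ a₀)
    (hcomp : ∀ n, n < k → cR * epsOfRecord ν g n ≤ 2 * (cR * epsOfRecord ν g (n + 1)))
    (hcomp' : ∀ n, n < k → cR * epsOfRecord ν g (n + 1) ≤ 2 * (cR * epsOfRecord ν g n))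
    {W : MSField (F.P K) (SU N)} (h7 : Sect2.DataSmall7PTop (avOfRecord F N K) s.Ω (Sup ν K s.Ω) k (fun n => cR * epsOfRecord ν g n) W)
    {U₀ : GaugeField (F.P K) 0 (SU N)} (hmin : IsMinimizer (avOfRecord F N K)
      {U | (∀ n, n ≤ k → PlaqSmallOn (Sect2.omegaPlaqsTop s.Ω (Sup ν K s.Ω) n) (ν.εreg * (F.P K).eta n ^ 2) U) ∧
        Sect2.CoDivClassOnTop s.Ω (Sup ν K s.Ω) k ν.εreg U} (genSet s.Ω k) W U₀) :
    ∀ n, n ≤ k → Sect2.CoDivSmallOn (Sect2.omegaBondsTop s.Ω (Sup ν K s.Ω) n) (B₃ * (cR * epsOfRecord ν g n) * (F.P K).eta n ^ 3) U₀ :=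
  (h15 ν M g K k s hsep ν.εreg (fun n => cR * epsOfRecord ν g n) hnum hcomp hcomp' ha₀ W h7 U₀ hmin).2

/-- **★★★ ROW P11's BODY AT `(s, 𝐖)` FOR EVERY MINIMISER `U₀` OVER THE TOP-DOMAIN CLASS (6), FROM THE TOP-DOMAIN FACT** — `VariationalThm1RegSepTop7` for the plaquette class bounds
at the scales `1 ≤ n ≤ k` (the scale-0 member, read on the support, is not needed by the row: FILE 12a's `bgRowAtDatumU_of_classBoundsC1Pos`), print's (7) on the datum over the support
(`h7`), the displayed C¹ class clause `B₃′·cR·ε_n·η_n³` for `U₀` ([15] Thm 1 (9)–(10), gauge-free reading), numerics incl. FILE 7c's two «C₀ large» letters, (C1)(C2), no wrapping, `hcomp`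
AND `hcomp'`.  NO `h9`.  def-R′ instantiates `Sup := suppDomOfRecord`, `U₀ := UbgMSCoPOfRecord … s W` (FILE 12c).
[cite: Balaban1985Variational, Thm 1 (2),(6)–(10) pp.278–279; Balaban1985RegularSpaces, (1.3)–(1.9) p.77; Balaban1988Convergent, (2.4)–(2.8) pp.255–256, (2.12) p.256, (2.27)–(2.28) p.259, (2.34)–(2.41) p.261; Balaban1987RG1, (1.11)–(1.16) p.262] -/
theorem bgRowAtDatumU_of_thm1RegSepTop7C1 {Sup : (ν : Stage7Numerics) → (K : ℕ) → (ℕ → Set (Site (F.P K) 0)) → Set (Site (F.P K) 0)} {B₃ B₃' a₀ a₁ tI tMS : ℝ}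
    (h15 : VariationalThm1RegSepTop7 F N Sup B₃ a₀ a₁)
    (S : Sect2.Setting (MatA N) (SU N)) (hι : S.ι = ιSU N) (h𝓜 : S.𝓜 = B12RegularSpaces111SpecialUnitary.suModel N) (hS : S.Laws) (hpos : S.Pos)
    (ν : Stage7Numerics) {M : ℕ} (hM : 0 < M) (K k : ℕ) (cR : ℝ) (hB₃ : 0 ≤ B₃) (hB₃' : 0 ≤ B₃')
    (hg : ∀ j, 1 ≤ j → j ≤ k → 0 < S.flow.g j ∧ S.flow.g j ^ 2 ≤ Real.exp (-1)) (hpq : ν.p₀ ≤ S.lf.q₀)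
    (hnum : ∀ n, n ≤ k → 0 < cR * epsOfRecord ν S.flow.g n ∧ cR * epsOfRecord ν S.flow.g n ≤ a₁ ∧ B₃ * (cR * epsOfRecord ν S.flow.g n) ≤ ν.εreg)
    (ha₀ : ν.εreg ≤ a₀) (hcomp : ∀ n, n < k → cR * epsOfRecord ν S.flow.g n ≤ 2 * (cR * epsOfRecord ν S.flow.g (n + 1)))
    (hcomp' : ∀ n, n < k → cR * epsOfRecord ν S.flow.g (n + 1) ≤ 2 * (cR * epsOfRecord ν S.flow.g n))
    (hα : ∀ n, 1 ≤ n → n ≤ k → 0 < S.lf.alpha0 (S.flow.g n) ∧ 0 < S.lf.alpha1 (S.flow.g n))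
    (hBα : ∀ n, 1 ≤ n → n ≤ k → B₃ * (cR * epsOfRecord ν S.flow.g n) ≤ (1 - S.βc) * S.lf.alpha0 (S.flow.g n))
    (hΛI0 : 0 ≤ (4 * (B₃ + (((F.P K).d - 1 : ℕ) : ℝ) * (((F.P K).L : ℝ) * M) * B₃') + 16 * ((((F.P K).d - 1 : ℕ) : ℝ) * (((F.P K).L : ℝ) * M)) ^ 2 * B₃ ^ 2 * a₁) * cR * ν.A₀)
    (hΛI : (4 * (B₃ + (((F.P K).d - 1 : ℕ) : ℝ) * (((F.P K).L : ℝ) * M) * B₃') + 16 * ((((F.P K).d - 1 : ℕ) : ℝ) * (((F.P K).L : ℝ) * M)) ^ 2 * B₃ ^ 2 * a₁) * cR * ν.A₀ ≤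
      tI * S.lf.C₀) (htI : tI < S.cB)
    (hΛMS0 : 0 ≤ (4 * (B₃ + (((F.P K).d - 1 : ℕ) : ℝ) * (M : ℝ) * B₃') + 16 * ((((F.P K).d - 1 : ℕ) : ℝ) * (M : ℝ)) ^ 2 * B₃ ^ 2 * a₁) * cR * ν.A₀)
    (hΛMS : (4 * (B₃ + (((F.P K).d - 1 : ℕ) : ℝ) * (M : ℝ) * B₃') + 16 * ((((F.P K).d - 1 : ℕ) : ℝ) * (M : ℝ)) ^ 2 * B₃ ^ 2 * a₁) * cR * ν.A₀ ≤ tMS * S.lf.C₀)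
    (htMS : tMS < S.B * S.C * S.Mr)
    (hsN : ∀ n, 1 ≤ n → n ≤ k + 1 → ((B14.Eq213MaximalDomains.side (F.P K).L M n : ℕ) : ℤ) < (F.P K).sitesPerDir 0)
    (hcB : 2 * (((F.P K).d - 1 : ℕ) : ℝ) * ((F.P K).L * M) < S.cB) (hBCM : 2 * (((F.P K).d - 1 : ℕ) : ℝ) * M < S.B * S.C * S.Mr)
    (hsmallI : ∀ j, 1 ≤ j → j ≤ k → (((F.P K).d - 1 : ℕ) : ℝ) * ((F.P K).L * M) * (F.P K).eta j * (B₃ * (cR * epsOfRecord ν S.flow.g j)) ≤ 1 / 2)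
    (hsmallMS : ∀ n, 1 ≤ n → n ≤ k → (((F.P K).d - 1 : ℕ) : ℝ) * M * (F.P K).eta n * (B₃ * (cR * epsOfRecord ν S.flow.g n)) ≤ 1 / 2)
    (hC1 : ∀ j, 1 ≤ j → j ≤ k → ∃ t : ℕ, 0 < t ∧ RkOfRecord (F.P K).L ν.r (S.flow.g j) = (F.P K).L * t)
    (hC2 : ∀ j, 1 ≤ j → j ≤ k → dCubeSide (F.P K).L M (RkOfRecord (F.P K).L ν.r (S.flow.g j)) j ∣ (F.P K).sitesPerDir 0)
    (s : SeqOfRecord F ν M S.flow.g K k) (hsep : Sect2.SeqSeparated ν.M₁ s) {W : MSField (F.P K) (SU N)}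
    (h7 : Sect2.DataSmall7PTop (avOfRecord F N K) s.Ω (Sup ν K s.Ω) k (fun n => cR * epsOfRecord ν S.flow.g n) W)
    {U₀ : GaugeField (F.P K) 0 (SU N)} (hmin : IsMinimizer (avOfRecord F N K)
      {U | (∀ n, n ≤ k → PlaqSmallOn (Sect2.omegaPlaqsTop s.Ω (Sup ν K s.Ω) n) (ν.εreg * (F.P K).eta n ^ 2) U) ∧
        Sect2.CoDivClassOnTop s.Ω (Sup ν K s.Ω) k ν.εreg U} (genSet s.Ω k) W U₀)
    (hclassC1 : ∀ n, 1 ≤ n → n ≤ k → PlaqC1SmallOn (plaqInside (s.Ω n)) (B₃' * (cR * epsOfRecord ν S.flow.g n) * (F.P K).eta n ^ 3) U₀) :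
    ∀ j, 1 ≤ j → j ≤ k → ∀ X : (Sect2.domSys (F.P K) M j).Dom,
      (Sect2.domSites (F.P K) M j X ⊆ s.Λ j →
        Sect2.ofBackgroundC S.ι (U₀) ∈
          Sect2.spaceI S (Sect2.Residual.unit (F.P K) (MatA N)) M j (Sect2.domSites (F.P K) M j X) (S.lf.alpha0 (S.flow.g j)) (S.lf.alpha1 (S.flow.g j))) ∧
      (Sect2.admB (F.P K) ν M S.flow.g s.Ω s.Λ j (Sect2.domSites (F.P K) M j X) = true →
        Sect2.ofBackgroundC S.ι (U₀) ∈
          Sect2.spaceMS S (Sect2.Residual.unit (F.P K) (MatA N)) M j (Sect2.domSites (F.P K) M j X) s.Ω) := by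
  have hplaq := plaqSmallOn_of_thm1RegSepTop7 h15 ν M S.flow.g K k cR s hsep hnum ha₀ hcomp hcomp' h7 hmin
  have hclass : ∀ n, 1 ≤ n → n ≤ k → PlaqSmallOn (omegaPlaqs s.Ω n) (B₃ * (cR * epsOfRecord ν S.flow.g n) * (F.P K).eta n ^ 2) U₀ := by
    intro n hn1 hnk
    have := hplaq n hnk
    rwa [Sect2.omegaPlaqsTop_of_ne_zero _ _ (Nat.one_le_iff_ne_zero.mp hn1)] at this
  exact bgRowAtDatumU_of_classBoundsC1Pos S hι h𝓜 hS hpos ν hM K k (fun n _ hn => mul_nonneg hB₃ (hnum n hn).1.le) (fun n _ hn => mul_nonneg hB₃' (hnum n hn).1.le) s U₀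
    hclass hclassC1 hα hBα hsN hcB hBCM hsmallI hsmallMS hC1 hC2
    (hletterI_of_numerics S.lf ν M hg hpq (fun j hj => ⟨(hnum j hj).1, (hnum j hj).2.1⟩) hΛI0 hΛI htI (fun j h1 hj => (hα j h1 hj).1))
    (hletterMS_of_numerics S.lf ν M hg hpq (fun n hn => ⟨(hnum n hn).1, (hnum n hn).2.1⟩) hΛMS0 hΛMS htMS (fun n h1 hn => (hα n h1 hn).1))

end SuppliersTop

end Literature.MathematicalPhysics.QuantumFieldTheory.Balaban1983to89.Node00

end
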